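import Summits.CriticalPhenomena.PercolationContinuityZ3.Theorems.Transplant.GrigorchukLamplighterAutNotVirtuallyNilpotent
import Summits.CriticalPhenomena.PercolationContinuityZ3.Theorems.Transplant.CayleyLeftFramesRank
import Summits.CriticalPhenomena.PercolationContinuityZ3.Theorems.Transplant.CayleySkeletonSign
import Summits.CriticalPhenomena.PercolationContinuityZ3.Theorems.Transplant.SiteTwoMaxArea
import HarnessLib

/-!
# The first Grigorchuk group has NO RANK-TWO CHARACTER: every homomorphism from a subgroup of `𝔊` to `ℤ²` (indeed to any torsion-free group) is trivial, and on
# every Cayley graph `Cay(𝔊; S)` every stabiliser-killing `ℤ²`-character of a group of automorphisms CONTAINING THE LEFT TRANSLATIONS is trivial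

builds on p205010 (kernel theorem, internal audit signed; external expert review pending) — nothing in this file uses p205010.  NEGATIVE (scope) record about the INPUT
of the covering route / the end state on the Cayley graphs of `𝔊` (the bundle of «AutEndStateFC» `AutCyl.conj4_of_orbitDatum_fc`: a subgroup `A₀ ≤ Aut(G)` with
finitely many orbits, a character `c : A₀ →* ℤ²` killing every vertex stabiliser, of rank two, …); no percolation statement; nothing about any `@[conjecture]`
node — in particular nothing about `BenjaminiSchramm1996_conj4_endState` —; `θ(p_c) = 0` on `Cay(𝔊; S)` stays NOT PROVED (tree and print).  Lane `prim-bschramm`,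
seat `prim-bschramm-stmt` gen 39 (lead g26 GO #8039 / RULING N5 #8047, N5a; refuter p5-g31 #8046 (1)–(2): decl named, scope ruled — GROUP(+) LEVEL typed here,
the FULL Aut level (translations not assumed inside `A₀`) is NOT typed and is OPEN for `Cay(𝔊; S)`).  Helper file (`--supports stmt-CriticalPhenomena-4575 --as helper`).
Def-free.

CONTENT.
* §1 (general, folklore) `TorsionChar.apply_eq_one`: a homomorphism from a TORSION group to a torsion-free monoid (`IsMulTorsionFree`, e.g. `Multiplicative ℤ`,
  `Multiplicative (Fin 2 → ℤ)`) is trivial; `subgroup_apply_eq_one`.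
* §2 for `𝔊` (kernel torsion: «GrigorchukTorsion» p591617 / `isTorsion_grigorchukGroup` p615715): `Grigorchuk.subgroup_char_eq_one` (every `ψ : A →* M`, `A ≤ 𝔊`,
  `M` torsion-free, is trivial), `toAdd_char_eq_zero`, **`det2_char_eq_zero` / `not_rankTwo_char`** (no `ψ : A →* ℤ²` on any subgroup has two values of
  non-zero determinant — the NEGATION of the input `hrank` of «CayleyVirtualRankTwoSomeGens» `CayleyVirtualRank.exists_gens_conj4` and of the conclusion of
  «AutEndStateCayley» `EndStateCayley.vb1_of_input`), **`characters_dependent`** (the NEGATION of `hind` of `EndStateCayley.criticalContinuity_of_endState` /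
  `exists_input_of_vb1` / `CayleyVirtualRank.exists_gens_conj4_of_two_characters`, via «CayleyLeftFramesRank» `LeftChart.characters_dependent_of_isTorsion`),
  `not_surjective_char` (no subgroup of `𝔊` maps onto `ℤ²`).
* §3 GROUP(+) LEVEL on `Cay(𝔊; S)`, `S ⊆ 𝔊` ANY finite subset: **`Grigorchuk.cayley_char_eq_one_of_leftMul_mem`** — for every subgroup `A₀ ≤ Aut(Cay(𝔊; S))`
  CONTAINING every left translation («CayleySkeletonSign» `leftMulIso S g`) and every `c : A₀ →* Multiplicative (Site 2)` with `c a = 1` whenever `a` fixes a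
  vertex, `c = 1`: `a = L(a 1) · (L(a 1)⁻¹ a)` with the second factor fixing the vertex `1`, and `c ∘ L` is a character of the torsion group `𝔊`.  Hence
  **`cayley_not_rankTwo_of_leftMul_mem`** (the bundle's `hrank` fails) and `cayley_no_char_ne_one_of_leftMul_mem` (its `hg : c g ≠ 1` fails) — the binders are
  literally those of `AutCyl.conj4_of_orbitDatum_fc`; `hrank`, `g`, `N`, `hN`, `horb` are NOT taken as hypotheses (they are idle: the conclusion needs only
  `hstab` and the translations).  NOT typed: the same for an `A₀` not containing the translations (nothing is known about `Aut(Cay(𝔊; S))` in tree or print).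
[cite: Grigorchuk1980, every element of 𝔊 has finite order] [cite: BenjaminiSchramm1996, Conj. 4; §2 (Cayley graphs)]
-/

noncomputable section

namespace Summit.CriticalPhenomena.PercolationContinuityZ3.Theorems.Transplant

open SimpleGraph Literature.Probability.LatticeModels
open scoped Classical

/-! ### §1 Characters of torsion groups -/

namespace TorsionChar

/-- **Every homomorphism from a torsion group to a torsion-free monoid is trivial** (the image of an element of finite order has finite order).
[folklore] -/
theorem apply_eq_one {Γ M : Type*} [Group Γ] [Monoid M] [IsMulTorsionFree M] (hΓ : Monoid.IsTorsion Γ) (ψ : Γ →* M) (g : Γ) : ψ g = 1 :=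
  (ψ.isOfFinOrder (hΓ g)).eq_one'

/-- … and so is every homomorphism from a SUBGROUP of a torsion group. [folklore] -/
theorem subgroup_apply_eq_one {Γ M : Type*} [Group Γ] [Monoid M] [IsMulTorsionFree M] (hΓ : Monoid.IsTorsion Γ) (A : Subgroup Γ) (ψ : A →* M)
    (x : A) : ψ x = 1 :=
  apply_eq_one (IsTorsion.subgroup hΓ A) ψ x

end TorsionChar

/-! ### §2 `𝔊`: no character, no rank-two character, no surjection onto `ℤ²` on any subgroup -/

namespace Grigorchuk

/-- **Every homomorphism from a subgroup of `𝔊` to a torsion-free monoid is trivial** (`𝔊` is torsion — kernel, p591617). [cite: Grigorchuk1980, every element of 𝔊 has finite order] -/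
theorem subgroup_char_eq_one {M : Type*} [Monoid M] [IsMulTorsionFree M] (A : Subgroup ↥grigorchukGroup) (ψ : A →* M) (x : A) : ψ x = 1 :=
  TorsionChar.subgroup_apply_eq_one isTorsion_grigorchukGroup A ψ x

/-- In particular every homomorphism `𝔊 → M`, `M` torsion-free, is trivial. [cite: Grigorchuk1980, every element of 𝔊 has finite order] -/
theorem char_eq_one {M : Type*} [Monoid M] [IsMulTorsionFree M] (ψ : ↥grigorchukGroup →* M) (g : ↥grigorchukGroup) : ψ g = 1 :=
  TorsionChar.apply_eq_one isTorsion_grigorchukGroup ψ g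

/-- Every `ℤ²`-character of every subgroup of `𝔊` vanishes (additive reading). [cite: Grigorchuk1980, every element of 𝔊 has finite order] -/
theorem toAdd_char_eq_zero (A : Subgroup ↥grigorchukGroup) (ψ : A →* Multiplicative (Site 2)) (x : A) : Multiplicative.toAdd (ψ x) = 0 := by
  rw [subgroup_char_eq_one A ψ x, toAdd_one]

/-- **No rank-two character**: any two values of a `ℤ²`-character of a subgroup of `𝔊` have determinant zero. [cite: Grigorchuk1980, every element of 𝔊 has finite order] -/
theorem det2_char_eq_zero (A : Subgroup ↥grigorchukGroup) (ψ : A →* Multiplicative (Site 2)) (x y : A) :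
    MaxArea.det2 (Multiplicative.toAdd (ψ x)) (Multiplicative.toAdd (ψ y)) = 0 := by
  rw [toAdd_char_eq_zero A ψ x, toAdd_char_eq_zero A ψ y, MaxArea.det2_self]

/-- **The rank-two input fails on every subgroup of `𝔊`** — literally the negation of the hypothesis `hrank` of «CayleyVirtualRankTwoSomeGens»
`CayleyVirtualRank.exists_gens_conj4` (and of the conclusion of «AutEndStateCayley» `EndStateCayley.vb1_of_input`) for `Γ = 𝔊`.
[cite: Grigorchuk1980, every element of 𝔊 has finite order] [cite: BenjaminiSchramm1996, Conj. 4; §2 (Cayley graphs)] -/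
theorem not_rankTwo_char (A : Subgroup ↥grigorchukGroup) (ψ : A →* Multiplicative (Site 2)) :
    ¬ ∃ x y : A, MaxArea.det2 (Multiplicative.toAdd (ψ x)) (Multiplicative.toAdd (ψ y)) ≠ 0 := by
  rintro ⟨x, y, h⟩
  exact h (det2_char_eq_zero A ψ x y)

/-- **All `ℤ`-characters of a subgroup of `𝔊` are pairwise dependent** (indeed zero) — literally the negation of the hypothesis `hind` of «AutEndStateCayley»
`EndStateCayley.criticalContinuity_of_endState` / `exists_input_of_vb1` and of «CayleyVirtualRankTwoSomeGens» `exists_gens_conj4_of_two_characters` for `Γ = 𝔊`.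
[cite: Grigorchuk1980, every element of 𝔊 has finite order] [cite: BenjaminiSchramm1996, Conj. 4; §2 (Cayley graphs)] -/
theorem characters_dependent (A : Subgroup ↥grigorchukGroup) (ψ₀ ψ₁ : A →* Multiplicative ℤ) (a b : A) :
    Multiplicative.toAdd (ψ₀ a) * Multiplicative.toAdd (ψ₁ b) = Multiplicative.toAdd (ψ₁ a) * Multiplicative.toAdd (ψ₀ b) :=
  LeftChart.characters_dependent_of_isTorsion (IsTorsion.subgroup isTorsion_grigorchukGroup A) ψ₀ ψ₁ a b

/-- **No subgroup of `𝔊` maps onto `ℤ²`.** [cite: Grigorchuk1980, every element of 𝔊 has finite order] -/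
theorem not_surjective_char (A : Subgroup ↥grigorchukGroup) (ψ : A →* Multiplicative (Site 2)) : ¬ Function.Surjective ψ := by
  intro h
  obtain ⟨x, hx⟩ := h (Multiplicative.ofAdd (Pi.single 0 1))
  have h0 := congrArg (fun v : Multiplicative (Site 2) => Multiplicative.toAdd v 0) hx
  simp only [toAdd_char_eq_zero A ψ x, Pi.zero_apply, toAdd_ofAdd, Pi.single_eq_same] at h0
  exact zero_ne_one h0

/-! ### §3 Group(+) level on the Cayley graphs of `𝔊`: automorphism groups containing the left translations -/

section Cayley

variable (S : Finset ↥grigorchukGroup)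

/-- **On `Cay(𝔊; S)` every stabiliser-killing `ℤ²`-character of a group of automorphisms CONTAINING THE LEFT TRANSLATIONS is trivial** (`S ⊆ 𝔊` any finite
subset): `a = L(a 1) · (L(a 1)⁻¹ a)`, the second factor fixes the vertex `1`, and `c ∘ L : 𝔊 → ℤ²` is a character of a torsion group.  The binders `A₀`, `c`,
`hstab` are those of «AutEndStateFC» `AutCyl.conj4_of_orbitDatum_fc`. [cite: Grigorchuk1980, every element of 𝔊 has finite order] [cite: BenjaminiSchramm1996, Conj. 4; §2 (Cayley graphs)] -/
theorem cayley_char_eq_one_of_leftMul_mem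
    (A₀ : Subgroup (mulCayley (↑S : Set ↥grigorchukGroup) ≃g mulCayley (↑S : Set ↥grigorchukGroup)))
    (hL : ∀ g : ↥grigorchukGroup, leftMulIso S g ∈ A₀) (c : A₀ →* Multiplicative (Site 2))
    (hstab : ∀ (a : A₀) (w : ↥grigorchukGroup), (a : mulCayley (↑S : Set ↥grigorchukGroup) ≃g mulCayley (↑S : Set ↥grigorchukGroup)) w = w → c a = 1)
    (a : A₀) : c a = 1 := by
  -- the left translations as a homomorphism into `A₀`
  let L : ↥grigorchukGroup →* A₀ :=
    { toFun := fun g => ⟨leftMulIso S g, hL g⟩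
      map_one' := Subtype.ext (RelIso.ext fun x => one_mul x)
      map_mul' := fun g h => Subtype.ext (RelIso.ext fun x => mul_assoc g h x) }
  -- `c ∘ L` is a character of the torsion group `𝔊`, hence trivial
  have hcL : ∀ g : ↥grigorchukGroup, c (L g) = 1 := fun g => char_eq_one (c.comp L) g
  have hinv : ∀ g : ↥grigorchukGroup, (leftMulIso S g)⁻¹ g = 1 := fun g => by
    have h := RelIso.inv_apply_self (leftMulIso S g) 1
    rwa [leftMulIso_apply, mul_one] at h
  -- split `a = L(a 1) · b` with `b` fixing the vertex `1`
  obtain ⟨g, hg⟩ : ∃ g : ↥grigorchukGroup, (a : mulCayley (↑S : Set ↥grigorchukGroup) ≃g mulCayley (↑S : Set ↥grigorchukGroup)) 1 = g := ⟨_, rfl⟩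
  have hb : (((L g)⁻¹ * a : A₀) : mulCayley (↑S : Set ↥grigorchukGroup) ≃g mulCayley (↑S : Set ↥grigorchukGroup)) 1 = 1 := by
    show ((leftMulIso S g)⁻¹ * (a : mulCayley (↑S : Set ↥grigorchukGroup) ≃g mulCayley (↑S : Set ↥grigorchukGroup))) 1 = 1
    rw [RelIso.mul_apply, hg, hinv]
  calc c a = c (L g * ((L g)⁻¹ * a)) := by rw [mul_inv_cancel_left]
    _ = 1 := by rw [map_mul, hcL g, one_mul, hstab _ 1 hb]

/-- **Hence the rank-two input `hrank` of `AutCyl.conj4_of_orbitDatum_fc` FAILS on `Cay(𝔊; S)` for every such `A₀`** (the covering / end-state leg is absent at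
group(+) level). [cite: Grigorchuk1980, every element of 𝔊 has finite order] [cite: BenjaminiSchramm1996, Conj. 4; §2 (Cayley graphs)] -/
theorem cayley_not_rankTwo_of_leftMul_mem
    (A₀ : Subgroup (mulCayley (↑S : Set ↥grigorchukGroup) ≃g mulCayley (↑S : Set ↥grigorchukGroup)))
    (hL : ∀ g : ↥grigorchukGroup, leftMulIso S g ∈ A₀) (c : A₀ →* Multiplicative (Site 2))
    (hstab : ∀ (a : A₀) (w : ↥grigorchukGroup), (a : mulCayley (↑S : Set ↥grigorchukGroup) ≃g mulCayley (↑S : Set ↥grigorchukGroup)) w = w → c a = 1) :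
    ¬ ∃ a b : A₀, MaxArea.det2 (Multiplicative.toAdd (c a)) (Multiplicative.toAdd (c b)) ≠ 0 := by
  rintro ⟨a, b, h⟩
  rw [cayley_char_eq_one_of_leftMul_mem S A₀ hL c hstab a, cayley_char_eq_one_of_leftMul_mem S A₀ hL c hstab b, toAdd_one,
    MaxArea.det2_self] at h
  exact h rfl

/-- … and so does its FC-witness input `hg : c g ≠ 1`: no element of such an `A₀` has non-trivial character.
[cite: Grigorchuk1980, every element of 𝔊 has finite order] [cite: BenjaminiSchramm1996, Conj. 4; §2 (Cayley graphs)] -/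
theorem cayley_no_char_ne_one_of_leftMul_mem
    (A₀ : Subgroup (mulCayley (↑S : Set ↥grigorchukGroup) ≃g mulCayley (↑S : Set ↥grigorchukGroup)))
    (hL : ∀ g : ↥grigorchukGroup, leftMulIso S g ∈ A₀) (c : A₀ →* Multiplicative (Site 2))
    (hstab : ∀ (a : A₀) (w : ↥grigorchukGroup), (a : mulCayley (↑S : Set ↥grigorchukGroup) ≃g mulCayley (↑S : Set ↥grigorchukGroup)) w = w → c a = 1) :
    ¬ ∃ g : A₀, c g ≠ 1 := by
  rintro ⟨g, hg⟩
  exact hg (cayley_char_eq_one_of_leftMul_mem S A₀ hL c hstab g)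

end Cayley

end Grigorchuk

end Summit.CriticalPhenomena.PercolationContinuityZ3.Theorems.Transplant

end
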